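import Summits.BirchSwinnertonDyer.Rank1Residual.Additive.KatoDescentRankOneCountTame
import Summits.BirchSwinnertonDyer.Rank1Residual.Additive.KatoDescentAugmentation
import Summits.BirchSwinnertonDyer.Rank1Residual.Additive.GordTorsionFiveSeven
import Summits.BirchSwinnertonDyer.BirchSwinnertonDyer.Theorems.RamifiedSevenEllipticUnitsFrameDataOfGZK
import Summits.BirchSwinnertonDyer.BirchSwinnertonDyer.Theorems.InertBadSignedBranchesLeafOfKMCPerrinRiou
import HarnessLib

set_option autoImplicit false

/-!
# STUB 3 ON THE TWO CRUXES' OWN ROWS from {GZK, lev, `Kato2004.thm12_4`} + the display H2X′ ONLY — the tame binder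
# `W(ℚ_p)[p] = 0` and the display PR-INV DISCHARGED on the rows of stmt-BirchSwinnertonDyer-19223 (`(p, I₀*)`, `p ≥ 5`)
# and of stmt-BirchSwinnertonDyer-19945 (𝒞₇ × {7}) (seat `bsd-cm-prr-ty1` g16, cell `bsd-cm`; theorems only: no definition,
# no named fact, no instance, no `sorry`)

Part 48 of the seat's kernel cut of stub 3 `stub_rankOneCountReadingKato` of the Kato–Perrin-Riou skeletons v4 (cruxes
stmt-BirchSwinnertonDyer-19945 `Cruxes/EllipticUnitValueSevenOfGZK/Lines/kato_perrin_riou_zp.lean` / -19223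
`Cruxes/CccOneLawOnTypeIstarZero/Lines/kato_perrin_riou_istar.lean`).  State of record before this file (Parts 37 and 47):
on the TAME rows (`h4 : ∀ R : (W.baseChange ℚ_[p]).toAffine.Point, p • R = 0 → R = 0`) the v5-recut body of stub 3 closes modulo
{GZK, lev, `thm12_4`, H2X′} + PR-INV (`StrictCount.rankOneCountReading_tame_of_facts`, Part 37), and PR-INV is a consequence of
{lev, `thm12_4`} (`PerrinRiouUnit.prInv_of_lev_of_thm12_4`, Part 47).  THIS FILE puts the two together and discharges the row binders
`h4`, `p ≠ 2`, `Addv W p`, `0 ≤ v_p j(W)`, `p ∤ #W(ℚ)_tors`, `Finite Ш(W)` on the two cruxes' own row predicates, so that on BOTH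
cruxes' rows the reading holds from EXACTLY three named print facts and one displayed print statement:
* §0 the tame binder on the rows.  **`noPTorsion_padic_of_hasSignedLocalType_IstarZero`**: for `W/ℚ` globally minimal of signed
  local type `(p, I₀*)` (`X12.O10.HasSignedLocalType`: CM, `p` inert in the CM field, bad at `p`, Kodaira symbol `I₀*` at the place
  over `p`), `p ≥ 5`: `W(ℚ_p)[p] = 0`.  Mazur's local step at an additive `p ≥ 5` READ OFF THE KODAIRA TYPE (tree
  `Additive.kodairaSymbolAt_of_prime_zsmul_eq_zero_of_addv`: a non-zero `p`-torsion point of `E(ℚ_p)` forces type II/III at `5`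
  or type II at `7` — never `I₀*`), the symbol transported from the place of `𝓞 ℚ` named by the type to the census place
  `placeOf p` of `ℤ` (`kodairaSymbolAt_placeOf_eq_of_natGenerator_eq`, both being Tate's algorithm over `ℤ_p`,
  `kodairaSymbolAt_eq_padic`).  This is the «K8 inert `W(ℚ_p)[p] = 0` lemma» left displayed by Part 37 (planner D554 (R-N4)).
  On 𝒞₇ × {7} the binder is the tree's `RamifiedSevenEllipticUnits.seven_nsmul_eq_zero_padic` (`d_K = −7`).
* §1 PR-INV discharged: **`rankOneCountReading_tame_of_lev_of_thm12_4`** / `…_cm_tame_…` = Part 37's two tame theorems fed with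
  Part 47's `prInv_of_lev_of_thm12_4 hlev h12`; hypotheses {GZK, lev, `thm12_4`, H2X′} ONLY.
* §2 **`rankOneCountReading_istarZero_of_facts (hGZK) (hlev) (h12) (hH2X')`** — the v5-recut body ON THE ROWS OF 19223, in the
  binder order of that skeleton's research stubs: `∀ p, 5 ≤ p → ∀ W, HasSignedLocalType W p (.Istar 0) → W.analyticRank = 1 →
  ∀ D ℒ, IsKatoZetaDescentDatumOfContra W p D → Kato2004.PRRatio W p ℒ → ⟨count conclusion⟩`; every other binder of the body
  (`p ≠ 2`, `Addv`, `0 ≤ v_p j`, `p ∤ #tors`, `Finite Ш`, CM, `h4`) is DISCHARGED (`p ≥ 5`; CM + bad ⇒ additive,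
  `not_mult_of_hasCM`; a CM `j` is an integer, tree `InertBadLeafKMCPerrinRiou.padicValRat_j_nonneg_of_hasCM`; §0 + `not_dvd_torsionOrder_of_noPTorsion`;
  GZK's finiteness conjunct; §0).
* §3 **`rankOneCountReading_classCSeven_of_facts (hGZK) (hlev) (h12) (hH2X')`** — the same ON THE ROWS OF 19945:
  `∀ W [Fact (Nat.Prime 7)], X12.ClassCSeven W → ∀ D ℒ, IsKatoZetaDescentDatumOfContra W 7 D → Kato2004.PRRatio W 7 ℒ → …`
  (side conditions by `X12.addv_of_hasCM_of_cmRamified`, `seven_nsmul_eq_zero_padic`, the integer `j`, GZK).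
READING OF RECORD after this file: on every row of 19223 (type `(p, I₀*)`, `p ≥ 5`) and of 19945 (𝒞₇ at `7`) the v5-recut stub 3
holds from {GZK `rank_eq_analyticRank_of_analyticRank_le_one`, lev `IsNewformOf.level_eq_conductorNorm`, `Kato2004.thm12_4`} + the
display H2X′ (Kato (14.9.1)→(17.13.1) + (12.2.3), Part 37's text VERBATIM) — NO count display, NO PR-INV display, NO tame binder.
HONEST LABEL: theorems only; the registered v4 stub 3 (unrestricted binders) is NOT closed and no recut is performed (planner/lead act,
ASK #3 (ρ4′)); nothing is asserted on 19945 / 19223; H2X′, `thm12_4`, GZK, lev are hypotheses (print facts, unproved in the tree);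
Kato's Main Conjecture and Perrin-Riou's conjecture are not touched; no summit statement is proved by this file; BSD is not proved
for any curve.  References: [Kato2004Asterisque] Thm. 12.4 (p. 221), §13.9 (p. 230), (14.9.1) (p. 239), (14.9.3) (p. 240), §14.14
(p. 243), Prop. 14.16 (p. 244), (17.13.1) (p. 279); [Mazur1977] Ch. III §5, Step 1 (p. 158); [SilvermanATAEC1994] IV.9.4 and
Table 4.1; [SilvermanAEC2009] App. C §11; [BurnsKuriharaSano2019] Thm. 7.3 (p. 29), Thm. 7.8 (d) (p. 30); [GrossZagier1986] Thm. I.7.3.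
-/

noncomputable section

open scoped Classical NumberField BigOperators ContRepresentation

open WeierstrassCurve Field IsDedekindDomain NumberField Rat.HeightOneSpectrum Literature.NumberTheory.EllipticCurves
  Literature.NumberTheory.EllipticCurves.ModularForms
  Literature.NumberTheory.EllipticCurves.Rank1Residual Literature.NumberTheory.EllipticCurves.Rank1Residual.Typed
  Literature.NumberTheory.EllipticCurves.Kato2004 Literature.NumberTheory.EllipticCurves.IwasawaAlgebra
  Literature.NumberTheory.EllipticCurves.Kato2004.EulerSystemValues
  Literature.NumberTheory.GaloisRepresentations Literature.NumberTheory.GaloisRepresentations.DiscreteGaloisModule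
  Literature.NumberTheory.DiophantineGeometry
open Summit.BirchSwinnertonDyer.Rank1Residual Summit.BirchSwinnertonDyer.Rank1Residual.Additive
  Summit.BirchSwinnertonDyer.Rank1Residual.X12.O10
open Summit.BirchSwinnertonDyer.BirchSwinnertonDyer.Theorems.RamifiedSevenEllipticUnits (seven_nsmul_eq_zero_padic)
open Summit.BirchSwinnertonDyer.BirchSwinnertonDyer.Theorems.InertBadLeafKMCPerrinRiou (padicValRat_j_nonneg_of_hasCM)

namespace Summit.BirchSwinnertonDyer.Rank1Residual.Additive.StrictCount

/-! ## §0 The tame binder `W(ℚ_p)[p] = 0` on the rows -/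

section Tame

variable (W : WeierstrassCurve ℚ) [W.IsElliptic] (p : ℕ) [hp : Fact p.Prime]

/-- Tate's algorithm at the census place `placeOf p` of `ℤ` and at a place `v` of `𝓞 ℚ` over `p` return the same Kodaira symbol
(both are the symbol of `W ⊗ ℚ_p` over `ℤ_p`, `kodairaSymbolAt_eq_padic`). [cite: SilvermanATAEC1994, IV.9.4 (PDF pp. 344–346)] -/
theorem kodairaSymbolAt_placeOf_eq_of_natGenerator_eq (v : HeightOneSpectrum (𝓞 ℚ)) (hv : natGenerator v = p) :
    W.kodairaSymbolAt (placeOf p) = W.kodairaSymbolAt v := by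
  let e : Nat.Primes → KodairaSymbol := fun q ↦
    haveI : Fact q.1.Prime := ⟨q.2⟩
    (W.baseChange ℚ_[q]).kodairaSymbol ℤ_[q]
  have h1 : W.kodairaSymbolAt (placeOf p) = e (primesEquiv (placeOf p)) := W.kodairaSymbolAt_eq_padic (placeOf p)
  have h2 : W.kodairaSymbolAt v = e (primesEquiv v) := W.kodairaSymbolAt_eq_padic v
  have h3 : primesEquiv (placeOf p) = primesEquiv v := by
    refine Subtype.ext ?_
    change natGenerator (placeOf p) = natGenerator v
    rw [hv]
    exact congrArg Subtype.val ((primesEquiv (R := ℤ)).apply_symm_apply ⟨p, hp.out⟩)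
  rw [h1, h2, h3]

/-- On a curve of signed local type `(p, T)` the census symbol at `placeOf p` is `T`. [cite: SilvermanATAEC1994, IV.9.4 and Table 4.1] -/
theorem kodairaSymbolAt_placeOf_of_hasSignedLocalType {T : KodairaSymbol} (hT : HasSignedLocalType W p T) :
    W.kodairaSymbolAt (placeOf p) = T := by
  have hv : natGenerator ((primesEquiv (R := 𝓞 ℚ)).symm ⟨p, hp.out⟩) = p :=
    congrArg Subtype.val ((primesEquiv (R := 𝓞 ℚ)).apply_symm_apply ⟨p, hp.out⟩)
  rw [kodairaSymbolAt_placeOf_eq_of_natGenerator_eq W p _ hv]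
  exact hT.2.2.2 _ hv

/-- A curve of a signed local type at `p` is ADDITIVE at `p` (bad by definition; a CM curve is never multiplicative,
`not_mult_of_hasCM`). [cite: SilvermanATAEC1994, Thm. II.6.4 (PDF p. 148)] -/
theorem addv_of_hasSignedLocalType {T : KodairaSymbol} (hT : HasSignedLocalType W p T) : Addv W p :=
  ⟨hT.2.2.1, not_mult_of_hasCM W hT.1 p⟩

/-- **`W(ℚ_p)[p] = 0` on the rows of 19223**: a globally minimal `W/ℚ` of signed local type `(p, I₀*)`, `p ≥ 5`, has no
`ℚ_p`-rational `p`-torsion — Mazur's local step at the additive prime `p` read off the Kodaira type (`p`-torsion forces II/III at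
`5`, II at `7`; never `I₀*`). [cite: Mazur1977, Ch. III §5, Step 1, p. 158] [cite: SilvermanATAEC1994, IV.9.4 and Table 4.1] -/
theorem noPTorsion_padic_of_hasSignedLocalType_IstarZero [W.IsGloballyMinimal] (hp5 : 5 ≤ p)
    (hT : HasSignedLocalType W p (.Istar 0)) :
    ∀ R : (W.baseChange ℚ_[p]).toAffine.Point, p • R = 0 → R = 0 := by
  intro R hR
  by_contra hR0
  have hI := kodairaSymbolAt_placeOf_of_hasSignedLocalType W p hT
  rcases kodairaSymbolAt_of_prime_zsmul_eq_zero_of_addv W p hp5 (addv_of_hasSignedLocalType W p hT) hR0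
      (by rw [natCast_zsmul]; exact hR) with ⟨-, h | h⟩ | ⟨-, h⟩ <;> rw [hI] at h <;> exact absurd h (by decide)

/-- Hence `p ∤ #W(ℚ)_tors` on the rows of 19223. [cite: Mazur1977, Ch. III §5, Step 1, p. 158] -/
theorem not_dvd_torsionOrder_of_hasSignedLocalType_IstarZero [W.IsGloballyMinimal] (hp5 : 5 ≤ p)
    (hT : HasSignedLocalType W p (.Istar 0)) : ¬ p ∣ W.torsionOrder :=
  not_dvd_torsionOrder_of_noPTorsion W p (noPTorsion_padic_of_hasSignedLocalType_IstarZero W p hp5 hT)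

end Tame

/-! ## §1 PR-INV discharged: the tame rows from {GZK, lev, `thm12_4`, H2X′} ONLY -/

section TameOfFacts

/-- **STUB 3 ON THE TAME ALL-ADDITIVE ROWS from {GZK, `IsNewformOf.level_eq_conductorNorm`, `Kato2004.thm12_4`, H2X′} ONLY** —
Part 37's `rankOneCountReading_tame_of_facts` with its PR-INV display fed by Part 47's theorem `PerrinRiouUnit.prInv_of_lev_of_thm12_4`.
Conclusion VERBATIM Part 37's (the v5-recut body + the all-additive clause + the tame binder).  CONDITIONAL on the four hypotheses;
the registered v4 stub is NOT closed. [cite: Kato2004Asterisque, Thm. 12.4 (p. 221), §13.9 (p. 230), (14.9.1) (p. 239), (14.9.3) (p. 240), §14.14 (p. 243), Prop. 14.16 (p. 244), (17.13.1) (p. 279)]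
[cite: BurnsKuriharaSano2019, Thm. 7.3 (p. 29) and Thm. 7.8 (d) (p. 30)] [cite: GrossZagier1986, Thm. I.7.3] -/
theorem rankOneCountReading_tame_of_lev_of_thm12_4
    (hGZK : rank_eq_analyticRank_of_analyticRank_le_one)
    (hlev : ∀ (N : ℕ) [NeZero N], IsNewformOf.level_eq_conductorNorm (N := N))
    (h12 : Kato2004.thm12_4)
    (hH2X' : ∀ (W : WeierstrassCurve ℚ) [W.IsElliptic] (p : ℕ) [Fact p.Prime] [ContinuousSMul ℤ_[p] (W.tateModule p)]
      (κ : ZpExtension ℚ p) (γ : absoluteGaloisGroup ℚ) (hγ : κ.IsTopGenerator γ) (v : HeightOneSpectrum (𝓞 ℚ)),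
      p ≠ 2 → κ.IsCyclotomic → ((Rat.HeightOneSpectrum.primesEquiv v : Nat.Primes) : ℕ) = p →
      ∀ I : IwasawaH1Data W p κ γ,
        ∃ (J : IwasawaH2Data W p κ γ I) (e : (W.fineSelmerDualData κ hγ).X →ₗ[IwasawaAlgebra p] J.H2)
          (c : (J.H2 ⧸ LinearMap.range e) →+
            CharacterModule ↥(FixedPoints.addSubgroup ↥(κ.kerSubgroup ⊓ GreenbergSelmer.decomp v) (W.geomPrimaryTorsion p))),
          Function.Injective e ∧ Function.Injective c) :
    ∀ (W : WeierstrassCurve ℚ) [W.IsElliptic] [W.IsGloballyMinimal] (p : ℕ) [Fact p.Prime]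
      (D : KatoDescentDatum p) (ℒ : ℚ_[p]),
      W.analyticRank = 1 → p ≠ 2 → Addv W p → 0 ≤ padicValRat p W.j → ¬ p ∣ W.torsionOrder →
      Finite W.sha →
      (∀ v ∈ W.badPlaces (𝓞 ℚ), ((Rat.HeightOneSpectrum.primesEquiv v : Nat.Primes) : ℕ) ≠ p →
        W.HasAdditiveReductionAt v) →
      (∀ R : (W.baseChange ℚ_[p]).toAffine.Point, p • R = 0 → R = 0) →
      IsKatoZetaDescentDatumOfContra W p D → Kato2004.PRRatio W p ℒ →
      Finite (coinvariants p D.H2) ∧ (ℒ ≠ 0 ↔ D.zetaIndex ≠ 0) ∧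
        ∀ m : ℕ, D.zetaIndex = p ^ m * D.h2Card →
          ℒ.valuation = (m : ℤ) +
            padicValNat p (Nat.card (AddCommGroup.primaryComponent W.sha p)) +
            padicValNat p W.tamagawaProduct :=
  rankOneCountReading_tame_of_facts hGZK hlev h12 hH2X' (PerrinRiouUnit.prInv_of_lev_of_thm12_4 hlev h12)

/-- **STUB 3 ON THE TAME CM ROWS from {GZK, lev, `thm12_4`, H2X′} ONLY** — Part 37's `rankOneCountReading_cm_tame_of_facts` with
PR-INV fed by Part 47.  Conclusion VERBATIM Part 37's (`W.HasCM →` and the tame binder after `Finite W.sha →`).  CONDITIONAL; the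
registered v4 stub is NOT closed. [cite: Kato2004Asterisque, Thm. 12.4 (p. 221), §13.9 (p. 230), (14.9.3) (p. 240), §14.14 (p. 243), Prop. 14.16 (p. 244), (17.13.1) (p. 279)]
[cite: SilvermanATAEC1994, proof of Thm. II.10.5 (p. 172)] [cite: GrossZagier1986, Thm. I.7.3] -/
theorem rankOneCountReading_cm_tame_of_lev_of_thm12_4
    (hGZK : rank_eq_analyticRank_of_analyticRank_le_one)
    (hlev : ∀ (N : ℕ) [NeZero N], IsNewformOf.level_eq_conductorNorm (N := N))
    (h12 : Kato2004.thm12_4)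
    (hH2X' : ∀ (W : WeierstrassCurve ℚ) [W.IsElliptic] (p : ℕ) [Fact p.Prime] [ContinuousSMul ℤ_[p] (W.tateModule p)]
      (κ : ZpExtension ℚ p) (γ : absoluteGaloisGroup ℚ) (hγ : κ.IsTopGenerator γ) (v : HeightOneSpectrum (𝓞 ℚ)),
      p ≠ 2 → κ.IsCyclotomic → ((Rat.HeightOneSpectrum.primesEquiv v : Nat.Primes) : ℕ) = p →
      ∀ I : IwasawaH1Data W p κ γ,
        ∃ (J : IwasawaH2Data W p κ γ I) (e : (W.fineSelmerDualData κ hγ).X →ₗ[IwasawaAlgebra p] J.H2)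
          (c : (J.H2 ⧸ LinearMap.range e) →+
            CharacterModule ↥(FixedPoints.addSubgroup ↥(κ.kerSubgroup ⊓ GreenbergSelmer.decomp v) (W.geomPrimaryTorsion p))),
          Function.Injective e ∧ Function.Injective c) :
    ∀ (W : WeierstrassCurve ℚ) [W.IsElliptic] [W.IsGloballyMinimal] (p : ℕ) [Fact p.Prime]
      (D : KatoDescentDatum p) (ℒ : ℚ_[p]),
      W.analyticRank = 1 → p ≠ 2 → Addv W p → 0 ≤ padicValRat p W.j → ¬ p ∣ W.torsionOrder →
      Finite W.sha →
      W.HasCM →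
      (∀ R : (W.baseChange ℚ_[p]).toAffine.Point, p • R = 0 → R = 0) →
      IsKatoZetaDescentDatumOfContra W p D → Kato2004.PRRatio W p ℒ →
      Finite (coinvariants p D.H2) ∧ (ℒ ≠ 0 ↔ D.zetaIndex ≠ 0) ∧
        ∀ m : ℕ, D.zetaIndex = p ^ m * D.h2Card →
          ℒ.valuation = (m : ℤ) +
            padicValNat p (Nat.card (AddCommGroup.primaryComponent W.sha p)) +
            padicValNat p W.tamagawaProduct :=
  rankOneCountReading_cm_tame_of_facts hGZK hlev h12 hH2X' (PerrinRiouUnit.prInv_of_lev_of_thm12_4 hlev h12)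

end TameOfFacts

/-! ## §2 The rows of stmt-BirchSwinnertonDyer-19223: signed local type `(p, I₀*)`, `p ≥ 5` -/

section IstarZero

/-- **STUB 3 ON THE ROWS OF 19223 from {GZK, lev, `thm12_4`} + H2X′ ONLY.**  For every prime `p ≥ 5` and every globally minimal
`W/ℚ` of signed local type `(p, I₀*)` (CM, `p` inert in the CM field, bad at `p`, Kodaira `I₀*` over `p`) of analytic rank one, every
Kato descent datum `D` of the print-exact key (`IsKatoZetaDescentDatumOfContra`) and every Kato–Perrin-Riou class `ℒ` (`Kato2004.PRRatio`):
`(D.H2)_Γ` is finite, `ℒ ≠ 0 ↔ D.zetaIndex ≠ 0`, and `D.zetaIndex = p^m · D.h2Card ⇒ v(ℒ) = m + v_p #Ш[p^∞] + v_p Tam` — the v5-recut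
body of `stub_rankOneCountReadingKato` with every row binder discharged: `p ≠ 2` (`p ≥ 5`), `Addv` (§0), `0 ≤ v_p j` (CM `j ∈ ℤ`),
`p ∤ #W(ℚ)_tors` and the tame binder (§0, Mazur's step read off the type `I₀*`), `Finite Ш` (GZK), `W.HasCM` (the type).  Binder
order = that of the skeleton's research stubs 1–2.  CONDITIONAL on the three named facts and the display H2X′; the registered v4
stub (unrestricted binders) is NOT closed; no recut is performed; nothing is asserted on 19223.
[cite: Kato2004Asterisque, Thm. 12.4 (p. 221), §13.9 (p. 230), (14.9.1) (p. 239), (14.9.3) (p. 240), §14.14 (p. 243), Prop. 14.16 (p. 244), (17.13.1) (p. 279)]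
[cite: Mazur1977, Ch. III §5, Step 1, p. 158] [cite: BurnsKuriharaSano2019, Thm. 7.3 (p. 29) and Thm. 7.8 (d) (p. 30)] [cite: GrossZagier1986, Thm. I.7.3] -/
theorem rankOneCountReading_istarZero_of_facts
    (hGZK : rank_eq_analyticRank_of_analyticRank_le_one)
    (hlev : ∀ (N : ℕ) [NeZero N], IsNewformOf.level_eq_conductorNorm (N := N))
    (h12 : Kato2004.thm12_4)
    (hH2X' : ∀ (W : WeierstrassCurve ℚ) [W.IsElliptic] (p : ℕ) [Fact p.Prime] [ContinuousSMul ℤ_[p] (W.tateModule p)]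
      (κ : ZpExtension ℚ p) (γ : absoluteGaloisGroup ℚ) (hγ : κ.IsTopGenerator γ) (v : HeightOneSpectrum (𝓞 ℚ)),
      p ≠ 2 → κ.IsCyclotomic → ((Rat.HeightOneSpectrum.primesEquiv v : Nat.Primes) : ℕ) = p →
      ∀ I : IwasawaH1Data W p κ γ,
        ∃ (J : IwasawaH2Data W p κ γ I) (e : (W.fineSelmerDualData κ hγ).X →ₗ[IwasawaAlgebra p] J.H2)
          (c : (J.H2 ⧸ LinearMap.range e) →+
            CharacterModule ↥(FixedPoints.addSubgroup ↥(κ.kerSubgroup ⊓ GreenbergSelmer.decomp v) (W.geomPrimaryTorsion p))),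
          Function.Injective e ∧ Function.Injective c) :
    ∀ (p : ℕ) [Fact p.Prime], 5 ≤ p → ∀ (W : WeierstrassCurve ℚ) [W.IsElliptic] [W.IsGloballyMinimal],
      HasSignedLocalType W p (.Istar 0) → W.analyticRank = 1 →
      ∀ (D : KatoDescentDatum p) (ℒ : ℚ_[p]),
        IsKatoZetaDescentDatumOfContra W p D → Kato2004.PRRatio W p ℒ →
        Finite (coinvariants p D.H2) ∧ (ℒ ≠ 0 ↔ D.zetaIndex ≠ 0) ∧
          ∀ m : ℕ, D.zetaIndex = p ^ m * D.h2Card →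
            ℒ.valuation = (m : ℤ) +
              padicValNat p (Nat.card (AddCommGroup.primaryComponent W.sha p)) +
              padicValNat p W.tamagawaProduct := by
  intro p _ hp5 W _ _ hT hr D ℒ hD hℒ
  have htame := noPTorsion_padic_of_hasSignedLocalType_IstarZero W p hp5 hT
  exact rankOneCountReading_cm_tame_of_lev_of_thm12_4 hGZK hlev h12 hH2X' W p D ℒ hr (by omega)
    (addv_of_hasSignedLocalType W p hT) (padicValRat_j_nonneg_of_hasCM W p hT.1)
    (not_dvd_torsionOrder_of_noPTorsion W p htame) (hGZK W (by rw [hr])).2 hT.1 htame hD hℒ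

end IstarZero

/-! ## §3 The rows of stmt-BirchSwinnertonDyer-19945: the class 𝒞₇ at `p = 7` -/

section ClassCSeven

/-- **STUB 3 ON THE ROWS OF 19945 from {GZK, lev, `thm12_4`} + H2X′ ONLY.**  For every globally minimal `W ∈ 𝒞₇` (`X12.ClassCSeven`:
CM by `ℚ(√−7)`, analytic rank one, good ordinary at `2`, bad primes `≠ 7` split), every Kato descent datum `D` of the print-exact key
at `7` and every Kato–Perrin-Riou class `ℒ` at `7`: the v5-recut body of `stub_rankOneCountReadingKato` at `(W, 7)`, every row binder
discharged: `7 ≠ 2`, `Addv W 7` (`X12.addv_of_hasCM_of_cmRamified`), `0 ≤ v₇ j` (CM `j ∈ ℤ`), `7 ∤ #W(ℚ)_tors` and the tame binder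
(`seven_nsmul_eq_zero_padic`, `d_K = −7`), `Finite Ш` (GZK), `W.HasCM`.  CONDITIONAL on the three named facts and the display H2X′;
the registered v4 stub (unrestricted binders) is NOT closed; no recut is performed; nothing is asserted on 19945.
[cite: Kato2004Asterisque, Thm. 12.4 (p. 221), §13.9 (p. 230), (14.9.1) (p. 239), (14.9.3) (p. 240), §14.14 (p. 243), Prop. 14.16 (p. 244), (17.13.1) (p. 279)]
[cite: Mazur1977, Ch. III §5, Step 1, p. 158] [cite: BurnsKuriharaSano2019, Thm. 7.3 (p. 29) and Thm. 7.8 (d) (p. 30)] [cite: GrossZagier1986, Thm. I.7.3] -/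
theorem rankOneCountReading_classCSeven_of_facts
    (hGZK : rank_eq_analyticRank_of_analyticRank_le_one)
    (hlev : ∀ (N : ℕ) [NeZero N], IsNewformOf.level_eq_conductorNorm (N := N))
    (h12 : Kato2004.thm12_4)
    (hH2X' : ∀ (W : WeierstrassCurve ℚ) [W.IsElliptic] (p : ℕ) [Fact p.Prime] [ContinuousSMul ℤ_[p] (W.tateModule p)]
      (κ : ZpExtension ℚ p) (γ : absoluteGaloisGroup ℚ) (hγ : κ.IsTopGenerator γ) (v : HeightOneSpectrum (𝓞 ℚ)),
      p ≠ 2 → κ.IsCyclotomic → ((Rat.HeightOneSpectrum.primesEquiv v : Nat.Primes) : ℕ) = p →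
      ∀ I : IwasawaH1Data W p κ γ,
        ∃ (J : IwasawaH2Data W p κ γ I) (e : (W.fineSelmerDualData κ hγ).X →ₗ[IwasawaAlgebra p] J.H2)
          (c : (J.H2 ⧸ LinearMap.range e) →+
            CharacterModule ↥(FixedPoints.addSubgroup ↥(κ.kerSubgroup ⊓ GreenbergSelmer.decomp v) (W.geomPrimaryTorsion p))),
          Function.Injective e ∧ Function.Injective c) :
    ∀ (W : WeierstrassCurve ℚ) [W.IsElliptic] [W.IsGloballyMinimal] [Fact (Nat.Prime 7)],
      X12.ClassCSeven W →
      ∀ (D : KatoDescentDatum 7) (ℒ : ℚ_[7]),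
        IsKatoZetaDescentDatumOfContra W 7 D → Kato2004.PRRatio W 7 ℒ →
        Finite (coinvariants 7 D.H2) ∧ (ℒ ≠ 0 ↔ D.zetaIndex ≠ 0) ∧
          ∀ m : ℕ, D.zetaIndex = 7 ^ m * D.h2Card →
            ℒ.valuation = (m : ℤ) +
              padicValNat 7 (Nat.card (AddCommGroup.primaryComponent W.sha 7)) +
              padicValNat 7 W.tamagawaProduct := by
  intro W _ _ _ h7 D ℒ hD hℒ
  have htame : ∀ R : (W.baseChange ℚ_[7]).toAffine.Point, 7 • R = 0 → R = 0 :=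
    fun R hR ↦ seven_nsmul_eq_zero_padic W h7.1 h7.2.1 R hR
  exact rankOneCountReading_cm_tame_of_lev_of_thm12_4 hGZK hlev h12 hH2X' W 7 D ℒ h7.2.2.1 (by norm_num)
    (X12.addv_of_hasCM_of_cmRamified W 7 h7.1 (by norm_num) (X12.ClassCSeven.cmRamified_seven h7))
    (padicValRat_j_nonneg_of_hasCM W 7 h7.1) (not_dvd_torsionOrder_of_noPTorsion W 7 htame)
    (hGZK W (by rw [h7.2.2.1])).2 h7.1 htame hD hℒ

end ClassCSeven

end Summit.BirchSwinnertonDyer.Rank1Residual.Additive.StrictCount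

end
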